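import Mathlib
import HarnessLib
import Literature.Computability.AlgebraicComplexity.PatternExpressions
import Summits.ValiantsHypothesis.ValiantsHypothesis.Theorems.MonotoneRestorationOrbitCompressionQPNarrowEsymmRowSums
import Summits.ValiantsHypothesis.ValiantsHypothesis.Theorems.MonotoneRestorationOrbitCompressionQPNarrowABP

/-!
# Route MonotoneRestoration — aside `OrbitCompressionQP` (stmt-ValiantsHypothesis-18332), line
# `expression_compression`: elementary symmetric polynomials of ANY family with short closed power sums —
# the full product `∏_{i,j} x_ij` and the column product are narrow of quasi-polynomial length

Generalisation of `Theorems/…NarrowEsymmRowSums.lean` through the symmetric-ABP criterion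
`NarrowClosure.narrowQP_of_matrixProduct`: whenever the power sums `Σ_i (v_n i)^b`, `b ≤ d n`, of a family of
polynomials `v_n : Fin (m n) → ℂ[x]` are values of `(1,1)`-label pattern expressions of quasi-polynomial length
(uniformly), the elementary symmetric polynomial `e_{d n}(v_n)` is narrow of quasi-polynomial length (Newton's
identities, `MvPolynomial.mul_esymm_eq_sum`, as an iterated product of `d n` matrices of dimension `d n + 1`).

* `newton_esymm_aeval` — Newton's identity, solved form, at an arbitrary evaluation;
* `narrowQP_esymm_of_powerSums` — the generic theorem;
* `narrowQP_fullProduct` — **the product of ALL `n²` variables `∏_{i,j} x_ij` is a `(1,1)`-label expression of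
  quasi-polynomial length** (`e_{n²}` of the entries; power sums `Σ_{i,j} x_ij^b = sumRow sumCol edge^b`);
  a single monomial on `n` rows and `n` columns of degree `n²`, outside both floors and — having the complete
  bipartite pattern `K_{n,n}` as its only homomorphism-polynomial term — outside the all-labelled span machine.

Helper file (`--supports stmt-ValiantsHypothesis-18332`); def-free; nothing here is a named fact; VP ≠ VNP is
not moved.
-/

noncomputable section

open MvPolynomial

-- `Summit.ValiantsHypothesis.ValiantsHypothesis.…` is the tree's single-conjunct layout (Sub = Summit).
set_option linter.dupNamespace false

namespace Summit.ValiantsHypothesis.ValiantsHypothesis.Theorems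

namespace NarrowClosure

open Literature.Computability.AlgebraicComplexity

/-- **Newton's identity, solved form, at an arbitrary evaluation** `v : σ → S` (`S` a commutative
`ℂ`-algebra, `m ≥ 1`): `e_m(v) = m⁻¹ (-1)^{m+1} Σ_{a < m} (-1)^a e_a(v) p_{m-a}(v)`. [folklore] -/
theorem newton_esymm_aeval {σ S : Type} [Fintype σ] [DecidableEq σ] [CommRing S] [Algebra ℂ S]
    (v : σ → S) (m : ℕ) (hm : 0 < m) :
    aeval v (esymm σ ℂ m) = algebraMap ℂ S ((m : ℂ)⁻¹ * (-1) ^ (m + 1)) *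
      ∑ a ∈ Finset.range m, (-1) ^ a * aeval v (esymm σ ℂ a) * ∑ i : σ, v i ^ (m - a) := by
  have key := congrArg (aeval v) (MvPolynomial.mul_esymm_eq_sum σ ℂ m)
  rw [map_mul, map_natCast, map_mul, map_pow, map_neg, map_one, map_sum] at key
  have hpsum : ∀ b : ℕ, aeval v (psum σ ℂ b) = ∑ i : σ, v i ^ b := by
    intro b; simp [psum, map_sum, map_pow]
  have hsum : ∑ a ∈ Finset.HasAntidiagonal.antidiagonal m with a.1 < m,
      aeval v ((-1) ^ a.1 * esymm σ ℂ a.1 * psum σ ℂ a.2) =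
      ∑ a ∈ Finset.range m, (-1) ^ a * aeval v (esymm σ ℂ a) * ∑ i : σ, v i ^ (m - a) := by
    rw [Finset.sum_filter, Finset.Nat.sum_antidiagonal_eq_sum_range_succ_mk, Finset.sum_range_succ]
    simp only [lt_irrefl, if_false, add_zero]
    refine Finset.sum_congr rfl fun a ha => ?_
    rw [if_pos (Finset.mem_range.1 ha), map_mul, map_mul, map_pow, map_neg, map_one, hpsum]
  rw [hsum] at key
  have hm0 : (m : ℂ) ≠ 0 := Nat.cast_ne_zero.2 hm.ne'
  calc aeval v (esymm σ ℂ m)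
      = algebraMap ℂ S ((m : ℂ)⁻¹ * (m : ℂ)) * aeval v (esymm σ ℂ m) := by
        rw [inv_mul_cancel₀ hm0, map_one, one_mul]
    _ = algebraMap ℂ S ((m : ℂ)⁻¹) * ((m : S) * aeval v (esymm σ ℂ m)) := by
        rw [map_mul, map_natCast, mul_assoc]
    _ = _ := by rw [key, map_mul, map_pow, map_neg, map_one]; ring

/-- **Elementary symmetric polynomials of a family with short closed power sums are narrow of
quasi-polynomial length.**  If, for one constant, the power sums `Σ_i (v n i)^b` (`b ≤ d n`) are values of
`(1,1)`-label expressions of length `≤ 2^{(log₂ n + c)^c}` and `d n ≤ 2^{(log₂ n + c)^c}`, then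
`n ↦ e_{d n}(v n)` satisfies the conclusion of `stub_narrowExpressionCompression`. [folklore] -/
theorem narrowQP_esymm_of_powerSums (m d : ℕ → ℕ)
    (v : (n : ℕ) → Fin (m n) → MvPolynomial (Fin n × Fin n) ℂ)
    (h : ∃ c : ℕ, ∀ n : ℕ, 1 ≤ n → d n ≤ 2 ^ ((Nat.log 2 n + c) ^ c) ∧
      ∀ b : ℕ, b ≤ d n → ∃ q : PatternExpr ℂ 1 1, q.length ≤ 2 ^ ((Nat.log 2 n + c) ^ c) ∧
        ∀ ρ γ : Fin 1 → Fin n, q.value n ρ γ = ∑ i : Fin (m n), v n i ^ b) :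
    ∃ c : ℕ, ∀ n : ℕ, 1 ≤ n → ∃ (k l : ℕ) (e : PatternExpr ℂ k l),
      n ^ (k + l) ≤ 2 ^ ((Nat.log 2 n + c) ^ c) ∧ e.length ≤ 2 ^ ((Nat.log 2 n + c) ^ c) ∧
      e.close n = aeval (v n) (esymm (Fin (m n)) ℂ (d n)) := by
  classical
  obtain ⟨a, ha⟩ := h
  obtain ⟨c₀, hc₀⟩ := qp_combine a 0
  refine narrowQP_of_matrixProduct _ ⟨max a c₀, fun n hn => ?_⟩
  obtain ⟨hd, hps⟩ := ha n hn
  set D := d n with hD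
  set E : ℕ → MvPolynomial (Fin n × Fin n) ℂ := fun j => aeval (v n) (esymm (Fin (m n)) ℂ j) with hE
  set Ps : ℕ → MvPolynomial (Fin n × Fin n) ℂ := fun b => ∑ i : Fin (m n), v n i ^ b with hPs
  have hE0 : E 0 = 1 := by simp [hE, esymm_zero]
  have hNewton : ∀ j : ℕ, 0 < j → j ≤ D →
      E j = algebraMap ℂ _ ((j : ℂ)⁻¹ * (-1) ^ (j + 1)) * ∑ b ∈ Finset.range j, (-1) ^ b * E b * Ps (j - b) :=
    fun j hj _ => newton_esymm_aeval (v n) j hj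
  -- power-sum expressions for `b ≤ D` (and a dummy beyond)
  have hps' : ∀ b : ℕ, ∃ q : PatternExpr ℂ 1 1, b ≤ D → q.length ≤ 2 ^ ((Nat.log 2 n + a) ^ a) ∧
      ∀ ρ γ : Fin 1 → Fin n, q.value n ρ γ = Ps b := by
    intro b
    by_cases hb : b ≤ D
    · obtain ⟨q, hq, hqv⟩ := hps b hb
      exact ⟨q, fun _ => ⟨hq, hqv⟩⟩
    · exact ⟨PatternExpr.const 0, fun h => absurd h hb⟩
  choose pw hpw using hps'
  -- the Newton matrices of expressions
  set Mx : ℕ → Matrix (Fin (D + 1)) (Fin (D + 1)) (PatternExpr ℂ 1 1) := fun u => Matrix.of fun i j =>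
    if (i : ℕ) = u + 1 then
      (if (j : ℕ) < u + 1 then
        PatternExpr.mul (PatternExpr.const ((((u + 1 : ℕ) : ℂ))⁻¹ * (-1) ^ (u + 2) * (-1) ^ (j : ℕ)))
          (pw (u + 1 - j))
       else PatternExpr.const 0)
    else (if i = j then PatternExpr.const 1 else PatternExpr.const 0) with hMx
  set Q : ℕ := 2 ^ ((Nat.log 2 n + a) ^ a) with hQ
  have hMx_len : ∀ u, u < D → ∀ i j, (Mx u i j).length ≤ Q + 2 := by
    intro u hu i j
    simp only [hMx, Matrix.of_apply]
    split_ifs with h1 h2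
    · simp only [PatternExpr.length]
      have := (hpw (u + 1 - (j : ℕ)) (by omega)).1
      omega
    all_goals simp [PatternExpr.length]
  have hMx_val : ∀ u, u < D → ∀ (ρ γ : Fin 1 → Fin n), ((Mx u).map fun e => e.value n ρ γ) =
      Matrix.of fun i j : Fin (D + 1) =>
        if (i : ℕ) = u + 1 then
          (if (j : ℕ) < u + 1 then
            algebraMap ℂ _ ((((u + 1 : ℕ) : ℂ))⁻¹ * (-1) ^ (u + 2) * (-1) ^ (j : ℕ)) * Ps (u + 1 - j)
           else 0)
        else (if i = j then 1 else 0) := by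
    intro u hu ρ γ
    ext i j
    simp only [hMx, Matrix.map_apply, Matrix.of_apply]
    split_ifs with h1 h2
    · rw [PatternExpr.value_mul, PatternExpr.value_const, (hpw (u + 1 - (j : ℕ)) (by omega)).2 ρ γ,
        MvPolynomial.algebraMap_eq]
    all_goals simp
  refine ⟨D + 1, (List.range D).reverse.map Mx, ⟨D, Nat.lt_succ_self D⟩, 0, ?_, ?_, ?_, ?_⟩
  · -- dimension `D + 1 ≤ 2 Q ≤ …`
    calc D + 1 ≤ (D + 2) * (0 + 2) := by omega
      _ ≤ 2 ^ ((Nat.log 2 n + c₀) ^ c₀) := hc₀ _ _ _ hd (Nat.zero_le _)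
      _ ≤ _ := Nat.pow_le_pow_right (by norm_num) (CompressionFloors.polylog_mono (le_max_right _ _))
  · rw [List.length_map, List.length_reverse, List.length_range]
    exact hd.trans (Nat.pow_le_pow_right (by norm_num) (CompressionFloors.polylog_mono (le_max_left _ _)))
  · intro M hM i j
    rw [List.mem_map] at hM
    obtain ⟨u, hu, rfl⟩ := hM
    have hu' : u < D := by simpa using hu
    calc (Mx u i j).length ≤ Q + 2 := hMx_len u hu' i j
      _ ≤ (Q + 2) * (0 + 2) := Nat.le_mul_of_pos_right _ (by norm_num)
      _ ≤ 2 ^ ((Nat.log 2 n + c₀) ^ c₀) := hc₀ _ _ _ le_rfl (Nat.zero_le _)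
      _ ≤ _ := Nat.pow_le_pow_right (by norm_num) (CompressionFloors.polylog_mono (le_max_right _ _))
  · intro ρ γ
    rw [List.map_map]
    simp only [Function.comp_def]
    rw [List.map_congr_left (fun u hu => hMx_val u (by simpa using hu) ρ γ)]
    have hcol := prod_newton_col_zero D E Ps hE0 hNewton D le_rfl ⟨D, Nat.lt_succ_self D⟩
    rw [if_pos le_rfl] at hcol
    exact hcol

/-- The power sums of the ENTRIES `Σ_{i,j} x_ij^b` are values of `(1,1)`-label expressions of length `2b + 3`.
[folklore] -/
theorem exists_entryPowerSumExpr (n b : ℕ) : ∃ q : PatternExpr ℂ 1 1, q.length = b * 2 + 3 ∧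
    ∀ (ρ γ : Fin 1 → Fin n), q.value n ρ γ =
      ∑ ij : Fin n × Fin n, (X ij : MvPolynomial (Fin n × Fin n) ℂ) ^ b := by
  obtain ⟨pw, hlen, hval⟩ := exists_value_eq_pow (PatternExpr.edge 0 0 : PatternExpr ℂ 1 1) b
  refine ⟨PatternExpr.sumRow 0 (PatternExpr.sumCol 0 pw), by simp [PatternExpr.length, hlen],
    fun ρ γ => ?_⟩
  simp only [PatternExpr.value_sumRow, PatternExpr.value_sumCol, hval, PatternExpr.value_edge,
    Function.update_self]
  rw [← Finset.sum_product', Finset.univ_product_univ]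

/-- **The product of all `n²` variables is narrow of quasi-polynomial length with ONE row and ONE column
label** (`e_{n²}` of the entries). [folklore] -/
theorem narrowQP_fullProduct :
    ∃ c : ℕ, ∀ n : ℕ, 1 ≤ n → ∃ (k l : ℕ) (e : PatternExpr ℂ k l),
      n ^ (k + l) ≤ 2 ^ ((Nat.log 2 n + c) ^ c) ∧ e.length ≤ 2 ^ ((Nat.log 2 n + c) ^ c) ∧
      e.close n = ∏ ij : Fin n × Fin n, (X ij : MvPolynomial (Fin n × Fin n) ℂ) := by
  classical
  obtain ⟨c₁, hc₁⟩ := CompressionFloors.labels_qp 1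
  obtain ⟨c₂, hc₂⟩ := qp_combine c₁ 0
  have hsq : ∀ n : ℕ, n * n ≤ 2 ^ ((Nat.log 2 n + c₁) ^ c₁) := fun n => by
    have := hc₁ n 1 (by rw [pow_one]; exact Nat.le_add_left 1 _)
    rwa [show (1 : ℕ) + 1 = 2 from rfl, pow_two] at this
  -- the hypothesis of the generic theorem for the entries reindexed by `Fin (n * n)`
  have key := narrowQP_esymm_of_powerSums (fun n => n * n) (fun n => n * n)
    (fun n i => X ((Fintype.equivFin (Fin n × Fin n)).symm (Fin.cast (by simp) i))) ⟨c₂, fun n hn => ⟨by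
      calc n * n ≤ (n * n + 2) * (0 + 2) := by nlinarith
        _ ≤ 2 ^ ((Nat.log 2 n + c₂) ^ c₂) := hc₂ _ _ _ (hsq n) (Nat.zero_le _), fun b hb => by
      obtain ⟨q, hq, hqv⟩ := exists_entryPowerSumExpr n b
      refine ⟨q, ?_, fun ρ γ => ?_⟩
      · calc q.length = b * 2 + 3 := hq
          _ ≤ (n * n + 2) * (0 + 2) := by omega
          _ ≤ 2 ^ ((Nat.log 2 n + c₂) ^ c₂) := hc₂ _ _ _ (hsq n) (Nat.zero_le _)
      · rw [hqv]
        exact Fintype.sum_equiv ((Fintype.equivFin (Fin n × Fin n)).trans (finCongr (by simp))) _ _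
          fun ij => by simp⟩⟩
  obtain ⟨c, hc⟩ := key
  refine ⟨c, fun n hn => ?_⟩
  obtain ⟨k, l, e, hkl, hlen, hclose⟩ := hc n hn
  refine ⟨k, l, e, hkl, hlen, ?_⟩
  rw [hclose]
  have h2 : Finset.powersetCard (n * n) (Finset.univ : Finset (Fin (n * n))) = {Finset.univ} := by
    have h := Finset.powersetCard_self (Finset.univ : Finset (Fin (n * n)))
    rwa [Finset.card_univ, Fintype.card_fin] at h
  have : esymm (Fin (n * n)) ℂ (n * n) = ∏ i : Fin (n * n), X i := by
    rw [MvPolynomial.esymm, h2, Finset.sum_singleton]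
  rw [this, map_prod]
  simp only [aeval_X]
  exact Fintype.prod_equiv ((finCongr (by simp)).trans (Fintype.equivFin (Fin n × Fin n)).symm) _ _
    fun i => rfl

end NarrowClosure

end Summit.ValiantsHypothesis.ValiantsHypothesis.Theorems

end
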